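import Summits.BirchSwinnertonDyer.BirchSwinnertonDyer.Theses.ErratumRoadFive
import Summits.BirchSwinnertonDyer.BirchSwinnertonDyer.Theorems.ErratumRoadFiveIMCDivRoadFFSigmaDataBNoDefect
import Summits.BirchSwinnertonDyer.BirchSwinnertonDyer.Theorems.ErratumRoadFiveIMCDivRoadFFFittingFrameBOfFacts
import HarnessLib

/-!
# Route `ErratumRoadFive` (rung K2, `p ≥ 5`), crux `IMCDivAtErratumDataAllR` (item stmt-BirchSwinnertonDyer-20169)
# BY THE ROUTE'S NAME, MODULO NAMED FACTS — the Road-FF certificate for the planner's `closes`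

Cell `bsd-stepL` (run/shared/lean/pub/bsd-stepL/), seat `bsd-stepL-imc-p1` (prover g10, 2026-08-27);
`--supports stmt-BirchSwinnertonDyer-20169 --as helper`. This file imports the route file (to name the crux decl)
and the two Road-FF stub theorems: imc-p1 g9's `Σ`-data `P2.RoadFF.sigmaDataAtErratumDataB_of_prop332_of_noTamagawaDefect`
(p500562) and imc-p1 g10's deciding stub `P2.RoadFF.fittingCongruenceFrameAtErratumDataB_of_facts` (p517689), and
composes them with g9's cut `P2.imcDivIntCoreFrameAtErratumDataB_of_roadFF_fitting` (p495387) — exactly the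
composition `IMCDivAtErratumDataAllR_of` of the registered skeleton `Cruxes/IMCDivAtErratumDataAllR/Lines/birth.lean`,
with every stub replaced by its proof from named facts.

## What this file proves

**`imcDivAtErratumDataAllR_of_facts`**: the crux `Summit.BirchSwinnertonDyer.BirchSwinnertonDyer.Theses.ErratumRoadFive.
IMCDivAtErratumDataAllR` (= `∀ W p, P2.IMCDivIntCoreFrameAtErratumDataB W p`: at every erratum datum and every X-slot
`𝔭bar ≠ 𝔭_{ι'}`, an integral ♭-BDP `p`-adic `L`-function `Q` at the frame `(ι', 𝔭_{ι'})` with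
`Ch_Λ(X_ac(E/K_∞)_{𝔭bar})·𝓞_{ℂ_p}⟦T⟧ ⊆ (Q)`) from SIX named facts —
* FIVE PUBLISHED: `prop332_charIdeal_XAc_sigma_change_of_noTamagawaDefect` ([JSW17] Prop. 3.3.2, corrected form),
  `rank_eq_analyticRank_of_analyticRank_le_one` (Gross–Zagier–Kolyvagin), `exists_isNewformOf` (modularity),
  `SkinnerUrban2014.prop323_XAc_equiv_XBigDecomp` ([SU14] Prop. 3.2.3, Shapiro), `SkinnerUrban2014.lemma319_finite_XBig`
  ([SU14] Lemma 3.1.9);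
* ONE OPEN, claim-tagged, UNREFEREED: `Castella2018.erratum_members_exists_isTorsion_charIdeal_le_congruence_OPEN` (the
  erratum's member package: frame of `f` [Cas18 Thm. 3.1], Hida members (a)(b) [Ski16 §2.6], Thm. 2.3 torsion and
  (2.5)_m via [FW21, Thm. 4.41], (c) [Cas20 Thm. 2.11]).
HONEST FRAMING: a certificate "crux ⟸ named facts", nothing more; CONDITIONAL on the six facts, one of them OPEN
(resting on the unrefereed erratum and arXiv:2107.13726 Thm. 4.41); the crux is NOT proved; the anticyclotomic main
conjecture is asserted nowhere; BSD is proved for no pair; no census number moves (T7); closes rung K2 of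
BirchSwinnertonDyer for NO pair. Theorems only (no definition, no named fact, no `sorry`).

References: [Castella2018Erratum] Thm. 1.1, Thm. 2.3, (2.4)–(2.5), proof of Thm. 1.1 (pp. 1–4); [FouquetWan2021]
Thm. 4.41 (PREPRINT); [JetchevSkinnerWan2017] Prop. 3.3.2; [SkinnerUrban2014] Prop. 3.2.3, Lemma 3.1.9;
[Skinner2016PacificMC] §2.3, §2.6, §3.1; [Castella2020JIMJ] Thm. 2.11; [Castella2018] Thm. 3.1, (3.1).
-/

set_option autoImplicit false

noncomputable section

open scoped Classical
open WeierstrassCurve NumberField IsDedekindDomain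
open Literature.NumberTheory.EllipticCurves Literature.NumberTheory.EllipticCurves.ModularForms
  Literature.NumberTheory.EllipticCurves.Rank1Residual Literature.NumberTheory.EllipticCurves.JetchevSkinnerWan2017
  Literature.NumberTheory.EllipticCurves.Castella2018
open Summit.BirchSwinnertonDyer.Rank1Residual.X11b

namespace Summit.BirchSwinnertonDyer.BirchSwinnertonDyer.Theorems

/-- **THE CRUX `IMCDivAtErratumDataAllR` BY NAME, MODULO NAMED FACTS (Road FF)** — `Σ`-data from [JSW17] Prop. 3.3.2
(corrected form) + GZK + modularity (imc-p1 g9, p500562), the two-slot Fitting congruence frame from the erratum's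
OPEN member package + [SU14] Prop. 3.2.3 + [SU14] Lemma 3.1.9 (imc-p1 g10, p517689), composed by the Road-FF cut
(p495387). CONDITIONAL on the six named facts, ONE of them OPEN and unrefereed; nothing is booked.
[claim: Castella2018Erratum, status: under-review] [claim: FouquetWan2021, status: under-review]
[cite: Castella2018Erratum, (2.4), Thm. 2.3 and proof of Thm. 1.1 (pp. 3–4)] [cite: JetchevSkinnerWan2017, Prop. 3.3.2]
[cite: SkinnerUrban2014, Prop. 3.2.3 and Lemma 3.1.9 (p. 20)] -/
theorem imcDivAtErratumDataAllR_of_facts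
    (h332 : prop332_charIdeal_XAc_sigma_change_of_noTamagawaDefect)
    (hGZK : rank_eq_analyticRank_of_analyticRank_le_one) (hnf : exists_isNewformOf)
    (hSh : SkinnerUrban2014.prop323_XAc_equiv_XBigDecomp) (hFG : SkinnerUrban2014.lemma319_finite_XBig)
    (hMem : erratum_members_exists_isTorsion_charIdeal_le_congruence_OPEN) :
    Summit.BirchSwinnertonDyer.BirchSwinnertonDyer.Theses.ErratumRoadFive.IMCDivAtErratumDataAllR :=
  fun W _ _ p _ ↦
    P2.imcDivIntCoreFrameAtErratumDataB_of_roadFF_fitting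
      (P2.RoadFF.sigmaDataAtErratumDataB_of_prop332_of_noTamagawaDefect W p h332 hGZK hnf)
      (P2.RoadFF.fittingCongruenceFrameAtErratumDataB_of_facts hMem hSh hFG W p)

/-- **The same certificate keyed to the route's HELD bundle `PublishedInputsIMCReduction`** (item 19283; binder `hF` of
K2's `closes`), which supplies GZK (conjunct 2) and modularity (conjunct 4): the crux `IMCDivAtErratumDataAllR` BY NAME
from `PublishedInputsIMCReduction` + [JSW17] Prop. 3.3.2 (corrected form) + [SU14] Prop. 3.2.3 + [SU14] Lemma 3.1.9 +
the erratum's OPEN member package — the shape a route-level `have h3 := …` would use. CONDITIONAL; nothing booked.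
[claim: Castella2018Erratum, status: under-review] [claim: FouquetWan2021, status: under-review]
[cite: Castella2018Erratum, (2.4), Thm. 2.3 and proof of Thm. 1.1 (pp. 3–4)] -/
theorem imcDivAtErratumDataAllR_of_publishedInputsIMCReduction_of_facts
    (hF : Summit.BirchSwinnertonDyer.BirchSwinnertonDyer.Theses.ErratumRoadFive.PublishedInputsIMCReduction)
    (h332 : prop332_charIdeal_XAc_sigma_change_of_noTamagawaDefect)
    (hSh : SkinnerUrban2014.prop323_XAc_equiv_XBigDecomp) (hFG : SkinnerUrban2014.lemma319_finite_XBig)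
    (hMem : erratum_members_exists_isTorsion_charIdeal_le_congruence_OPEN) :
    Summit.BirchSwinnertonDyer.BirchSwinnertonDyer.Theses.ErratumRoadFive.IMCDivAtErratumDataAllR :=
  imcDivAtErratumDataAllR_of_facts h332 hF.2.1 hF.2.2.2.1 hSh hFG hMem

end Summit.BirchSwinnertonDyer.BirchSwinnertonDyer.Theorems

end
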